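import Literature.MathematicalPhysics.QuantumFieldTheory.Balaban1983to89.B1Ineq238RegularRegion
import Literature.MathematicalPhysics.QuantumFieldTheory.Balaban1983to89.B1Ineq233Upper
import Literature.MathematicalPhysics.QuantumFieldTheory.Balaban1983to89.B1

/-!
# `Balaban1983to89.B1Prop23RegularRegionFam` — T. Bałaban, *(Higgs)₂,₃ quantum fields in a finite volume. I. A lower bound*,
# Commun. Math. Phys. **85** (1982) 603–626 [Balaban1982Higgs1], PROPOSITION 2.3 (2.33)–(2.38) pp. 611–612: **THE TYPED STATEMENT
# `B1.Prop23Intended` (= B4's `Prop23Printed`, the intended reading «for e(L^kε) sufficiently small») INHABITED BY THE CONCRETE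
# (Higgs)₂,₃ CARRIER AT EVERY (2.23)-REGULAR `A ≠ 0` FOR NESTED PRINTED REGIONS `Ω = B^k(Λ_k) ⊆ Ω₀ = B^k(Λ⁰_k)`, `Λ ⊂ Λ_k`, `1 ≤ k < K`** —
# the family of `B4.UnitSetting`s indexed by (torus, charge data, two region towers, level, `Λ`, vector field `A`, regularity bound `δ_A`),
# all four clauses (2.33), (2.34), (2.36), (2.38) for the UNIT-LATTICE operators (factor `(L^kε)^{∓2}`, (2.22)/(2.31)), fed by r14 g13's
# (2.33)ₗ (`B1Ineq233LowerRegularOnRegion`), r14 g6's (2.33) upper half (`B1Ineq233Upper`), r14 g14's (2.34)/(2.36) (`B1Prop23RegularRegion`)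
# and (2.38) (`B1Ineq238RegularRegion`)

statement-level skeleton of published theorems with citation tags; proofs where landed; nothing here is a claim about the Yang–Mills mass gap

PDF held: `paper:balaban1982-cmp85-higgs23-i` (journal page = PDF page + 602), p. 611 [PDF 9] Prop. 2.3 (2.33)–(2.35), p. 612 [PDF 10]
(2.36)–(2.38), p. 610 [PDF 8] (2.22)–(2.23) (OCR `p0008.txt`–`p0010.txt` re-read by this seat; displays (2.33)/(2.34) read on the render by ref-1).

CITATION HEADER (lean-in-tree rule).  Cell `lit-balaban` (HOME `run/shared/lean/pub/lit-balaban/`), reader/typer seat **r14** gen 14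
(unit `lit-balaban-r14`, B1 fold owner; TAKING line HOME/STATUS.md 2026-08-22T07:18:39Z).  SKELETON row **B1.Prop2.3**: decls of record
`B1.Prop23Literal` / `B1.Prop23Intended` (pv07, over b04's abstract carrier `B4.UnitSetting`; `prop23Intended_iff_prop23Printed`); head «proved …»
by p17's `B4Prop23RegularFamily` on the b04 carrier.  THIS file: the typed `B1.Prop23Intended` INHABITED BY A FAMILY BUILT FROM THE CONCRETE
(Higgs)₂,₃ CARRIER at every (2.23)-regular `A` for nested printed regions — a MODEL INSTANCE on the cell's own carrier.
USED BY NAME, never restated: pv07 `B1.{Prop23Intended, Ineq233_238}`, b04 `B4.UnitSetting`, r14 g13 `B1Ineq233LowerRegularOnRegion.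
ineq233_lower_printed_region`, r14 g6 `B1Ineq233Upper.siteInner_precOpA_succ_le_uniform`, r14 g14 `B1Prop23RegularRegion.prop23_regular_region`,
`B1Ineq238RegularRegion.prop23_238_regular_region`, `B1Ineq18RegularRegion.two_le_sitesPerDir`, r14 g9 `B1Ineq234ZeroFieldRegion.extL_restrict_eq`,
r14 g7 `B1Ineq234Concrete.distC`, typer `B1Eq230FluctCov.{mat, precOpA}`, `HiggsCondCov232.condCov232`, p15 `B2Eq328ConcretePieces.{pieceF, LSite}`,
`B2Prop31ZeroFieldConcrete.mem_pieceF_iff`, `B2Eq337ScalarIntegration.Regions`.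

WHAT IS PRINTED (verbatim, [B1] pp. 611–612, OCR `p0009.txt` l. 30–35, `p0010.txt` l. 2–8): *"Here we will assume that the set Λ is a union
of big blocks of T^{(k)}_1. Proposition 2.3. If a configuration A is regular on Ω in the sense defined in Proposition 2.1, then there exist
positive constants δ₀, c₀, γ₀, γ₁ dependent on d and a, and independent of A, k, Ω and Λ, such that"* [(2.33): `γ₀I ≦ aL^{−2}P(A) + Δ^{(k)}(Ω, A)
≦ γ₁I`] [(2.34): `|C^{(k)}_Λ(Ω, A; x, x′)| ≦ c₀exp(−δ₀|x − x′|)`] *"x, x′ ∈ Λ. (2.34) In particular the above inequality holds for C^{(k)}(Ω, A).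
Putting δC^{(k)}_Λ(Ω, A) = C^{(k)}_Λ(Ω, A) − C^{(k)}(Ω, A), (2.35) we have |δC^{(k)}_Λ(Ω, A; x, x′)| ≦ c₀exp(−δ₀(|x − x′| + dist(x, Λᶜ) +
dist(x′, Λᶜ))), x, x′ ∈ Λ. (2.36) Similarly for Ω ⊂ Ω₀ and δC^{(k)}_Λ(Ω, Ω₀, A) = C^{(k)}_Λ(Ω, A) − C^{(k)}_Λ(Ω₀, A), (2.37) we have
|δC^{(k)}_Λ(Ω, Ω₀, A; x, x′)| ≦ c₀exp(−δ₀(|x − x′| + dist(x, Ω^{(k)c}) + dist(x′, Ω^{(k)c}))), x, x′ ∈ Λ. (2.38)"*.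

THE FAMILY (dictionary of each field of `B4.UnitSetting`).  Index `i` = a torus `P` (`P.d = d`, `P.L = L`); charge data `C`; two region
towers `R, R₀ : Regions P K` of p15 (`K ≤ K_P`) and a level `k = j + 1 < K_P` with `L^kε ≤ 1`, `Λ_k = R.block j ⊆ Λ⁰_k = R₀.block j` (`Ω =
B^k(Λ_k) = pieceF R j ⊆ Ω₀ = pieceF R₀ j`); `Λ ⊆ Λ_k`; a vector field `A`; a regularity bound `δ_A`.  `LSite` := coordinate indices `(x, i)`,
`x ∈ Λ`; `e := |e|` (the bare charge of `C` — the small parameter of the cell's regular-field files; «e(L^kε) sufficiently small»); `regular` :=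
`0 ≤ δ_A ∧ (|A ⟨z + εe_ν, μ⟩ − A ⟨z, μ⟩| ≤ δ_A on Ω₀) ∧ L^kδ_A ≤ c|e|` — (2.23) in lattice units (r14 g13's dictionary), `c ≥ 0` a family
parameter; `bigBlocks` := `Λ_k` and `Λ⁰_k` are unions of blocks (WEAKER than the printed «big blocks»; `Λ ⊂ Λ_k` itself arbitrary); `udist` := (1.3)
of `T^{(k)}`; `distLc := dist(·, Λᶜ)`, `distOc := dist(·, Λ_kᶜ)` (`distC`); `kerC := (L^kε)^{−2}|C^{(k),L^kε}_Λ(Ω,A)((x,i),(x′,i′))|`, `kerDC :=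
(L^kε)^{−2}|(C^{(k),L^kε}_Λ − C^{(k),L^kε}_{Λ_k})(Ω,A)(…)|` ((2.35) in the printed reading: `C^{(k)}(Ω,A)` = the member `Λ = Ω^{(k)}`), `kerDC0 :=
(L^kε)^{−2}|(C^{(k),L^kε}_Λ(Ω,A) − C^{(k),L^kε}_Λ(Ω₀,A))(…)|` — the unit-lattice covariances (2.31)–(2.32) = `(L^kε)^{−2}`× those of (2.30);
`form115 γ₀ γ₁` := (2.33) for the unit-lattice operator on the configurations on `Ω^{(k)}`: `γ₀(L^kε)^{−2}‖f‖² ≤ ⟨f, (a(L^{k+1}ε)^{−2}P(A) +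
Δ^{(k),L^kε}(Ω,A))f⟩ ≤ γ₁(L^kε)^{−2}‖f‖²` for every `f` on `T^{(k)}` vanishing off `Λ_k`.  Family parameters: `d, L, N, a, m², c`.

WHAT THIS FILE PROVES (kernel-checked, zero `sorry`; axioms standard).
* `RegNestIdx`, **`regNestFam23`** (the family, all fields with bodies).
* **`prop23Intended_regNestFam23`**: for `d`, `L > 1`, `N`, `a > 0`, `m² > 0`, `c ≥ 0`: `B1.Prop23Intended (regNestFam23 d L N a m² c)` — constants
  `γ₀ = γ` of r14 g13, `γ₁ = aL^{−2} + a` (r14 g6), `(c₀, δ₀) = (c₁ + c₁′, min{δ₁, δ₁′})` of r14 g14's two printed-shape theorems, `e₁ = √min{E₀, E₀′,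
  E₀″}`; hence also `B4.Prop23Printed (regNestFam23 …)` (`prop23Printed_regNestFam23`, by pv07's `prop23Intended_iff_prop23Printed`).
* `regNestFam23_nonvacuous`: members with `regular ∧ bigBlocks ∧ 0 < e ≤ e₁` exist for every `e₁ > 0`.
HONEST SCOPE.  (i) A MODEL INSTANCE of the typed statement on the concrete carrier; constants depend on `(d, N, L, a, m², c)` — WEAKER than the
printed «dependent on d and a»; (ii) entrywise kernels over coordinate indices `(x, i)`; (iii) `bigBlocks` = unions of `L`-blocks for `Λ_k`, `Λ⁰_k`
(stronger theorem than with big blocks); (iv) METHOD of the inputs: Combes–Thomas / energy comparison / small-field block Poincaré, NOT the print's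
random walk; (v) NOT summit progress.
-/

noncomputable section

open scoped BigOperators InnerProductSpace Matrix

namespace Literature.MathematicalPhysics.QuantumFieldTheory.Balaban1983to89.B1Prop23RegularRegionFam

open HiggsLattice HiggsAveraging HiggsCovariance HiggsCovariancePos B1Eq230FluctCov HiggsCondCov232
open B2Eq337ScalarIntegration (Regions V)
open B2Eq328ConcretePieces (LSite pieceF)
open B2Eq328DeltaK (extL)
open B2Prop31ZeroFieldConcrete (mem_pieceF_iff)
open B1Ineq234Concrete (distC distC_nonneg)
open B1Ineq234ZeroFieldRegion (extL_restrict_eq)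
open B1Ineq18RegularRegion (two_le_sitesPerDir)
open B1Ineq233LowerRegularOnRegion (ineq233_lower_printed_region)
open B1Ineq233Upper (siteInner_precOpA_succ_le_uniform)
open B1Prop23RegularRegion (prop23_regular_region)
open B1Ineq238RegularRegion (prop23_238_regular_region)
open Matrix

variable {N : ℕ}

/-! ## §1 The index set and the family -/

/-- An index of the family: torus, charge data, two region towers with a level, `Λ ⊆ Λ_k`, a vector field, a regularity bound.
[cite: Balaban1982Higgs1, Prop. 2.3 pp.611–612, (2.23) p.610] -/
structure RegNestIdx (d L : ℕ) (N : ℕ) where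
  /-- the torus of the carrier -/
  P : HiggsLattice.Params
  hPd : P.d = d
  hPL : P.L = L
  /-- the charge data `(e, q)` -/
  C : ChargeData N
  /-- the two region towers and the level `k = j + 1` -/
  K : ℕ
  hK : K ≤ P.K
  R : Regions P K
  R₀ : Regions P K
  j : Fin K
  hjK : j.val + 1 < P.K
  hs : P.mesh (j.val + 1) ≤ 1
  hsubΛ : R.block j ⊆ R₀.block j
  /-- `Λ ⊆ Λ_k = Ω^{(k)}` -/
  Λ : Finset (HiggsLattice.Site P (j.val + 1))
  hΛ : Λ ⊆ R.block j
  /-- the vector field on the bonds of `T_ε` and its regularity bound -/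
  A : HiggsLattice.VecField P 0
  δA : ℝ

/-- **THE FAMILY OF SETTINGS OF PROP. 2.3 BUILT FROM THE (Higgs)₂,₃ CARRIER AT EVERY (2.23)-REGULAR FIELD, NESTED PRINTED REGIONS** (module
docstring «THE FAMILY» for the reading of each field). [cite: Balaban1982Higgs1, Prop. 2.3 (2.30)–(2.38) pp.611–612; (2.22)–(2.23) p.610] -/
def regNestFam23 (d L : ℕ) (N : ℕ) (a msq c : ℝ) (i : RegNestIdx d L N) : B4.UnitSetting where
  LSite := {p : HiggsLattice.Site i.P (i.j.val + 1) × Ix N // p.1 ∈ i.Λ}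
  e := |i.C.e|
  regular := 0 ≤ i.δA ∧
    (∀ z ∈ pieceF i.R₀ i.j, ∀ μ' ν : Fin i.P.d, |i.A ⟨z.shift ν, μ'⟩ - i.A ⟨z, μ'⟩| ≤ i.δA) ∧
    (i.P.L : ℝ) ^ (i.j.val + 1) * i.δA ≤ c * |i.C.e|
  bigBlocks :=
    (∀ y y' : HiggsLattice.Site i.P (i.j.val + 1),
      HiggsLattice.blockOf y = HiggsLattice.blockOf y' → (y ∈ i.R.block i.j ↔ y' ∈ i.R.block i.j)) ∧
    (∀ y y' : HiggsLattice.Site i.P (i.j.val + 1),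
      HiggsLattice.blockOf y = HiggsLattice.blockOf y' → (y ∈ i.R₀.block i.j ↔ y' ∈ i.R₀.block i.j))
  udist := fun p q => (HiggsLattice.Site.tdist p.1.1 q.1.1 : ℝ)
  distLc := fun p => distC i.Λ p.1.1
  distOc := fun p => distC (i.R.block i.j) p.1.1
  kerC := fun p q => (i.P.mesh (i.j.val + 1))⁻¹ ^ 2 *
    |mat (condCov232 i.C (pieceF i.R i.j) i.A msq a (i.j.val + 1) i.Λ) p.1 q.1|
  kerDC := fun p q => (i.P.mesh (i.j.val + 1))⁻¹ ^ 2 *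
    |mat (condCov232 i.C (pieceF i.R i.j) i.A msq a (i.j.val + 1) i.Λ) p.1 q.1
      - mat (condCov232 i.C (pieceF i.R i.j) i.A msq a (i.j.val + 1) (i.R.block i.j)) p.1 q.1|
  kerDC0 := fun p q => (i.P.mesh (i.j.val + 1))⁻¹ ^ 2 *
    |mat (condCov232 i.C (pieceF i.R i.j) i.A msq a (i.j.val + 1) i.Λ) p.1 q.1
      - mat (condCov232 i.C (pieceF i.R₀ i.j) i.A msq a (i.j.val + 1) i.Λ) p.1 q.1|
  form115 := fun γ₀ γ₁ => ∀ f : ScalarField i.P (i.j.val + 1) N, (∀ y, y ∉ i.R.block i.j → f y = 0) →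
    γ₀ * (i.P.mesh (i.j.val + 1))⁻¹ ^ 2 * siteInner f f
        ≤ siteInner f (precOpA i.C (pieceF i.R i.j) i.A msq a (i.j.val + 1) f) ∧
      siteInner f (precOpA i.C (pieceF i.R i.j) i.A msq a (i.j.val + 1) f)
        ≤ γ₁ * (i.P.mesh (i.j.val + 1))⁻¹ ^ 2 * siteInner f f

/-! ## §2 The typed statement `B1.Prop23Intended` on the family -/

/-- exponential weights compare: `c ≦ c′`, `δ′ ≦ δ`, `s ≧ 0` ⇒ `c·e^{−δs} ≦ c′·e^{−δ′s}`. [folklore] -/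
private theorem weight_mono {c c' δ δ' s : ℝ} (hc : c ≤ c') (hc' : 0 ≤ c') (hδ : δ' ≤ δ) (hs : 0 ≤ s) :
    c * Real.exp (-(δ * s)) ≤ c' * Real.exp (-(δ' * s)) := by
  have h1 : Real.exp (-(δ * s)) ≤ Real.exp (-(δ' * s)) := Real.exp_le_exp.2 (by nlinarith)
  exact (mul_le_mul_of_nonneg_right hc (Real.exp_nonneg _)).trans (mul_le_mul_of_nonneg_left h1 hc')

/-- the unit-lattice rescaling cancels: `(L^kε)^{−2}·((L^kε)²·X) = X`. [folklore] -/
private theorem inv_sq_mul_sq_mul {m : ℝ} (hm : 0 < m) (X : ℝ) : m⁻¹ ^ 2 * (m ^ 2 * X) = X := by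
  rw [← mul_assoc, inv_pow, inv_mul_cancel₀ (pow_ne_zero 2 hm.ne'), one_mul]

/-- **[B1] PROPOSITION 2.3 IN ITS TYPED INTENDED READING `B1.Prop23Intended` HOLDS ON THE CARRIER FAMILY `regNestFam23`**: for `d`, `L > 1`,
`N`, `a > 0`, `m² > 0`, `c ≥ 0` there are `δ₀, c₀, γ₀, γ₁, e₁ > 0` such that EVERY member (torus with these `d, L`, charge data, region towers,
level, `Λ`, field `A`, bound `δ_A`) which is regular on `Ω₀`, whose `Λ_k`, `Λ⁰_k` are unions of blocks, and with `0 < |e| ≤ e₁`, satisfies (2.33),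
(2.34), (2.36), (2.38) for the unit-lattice operators with these constants: `γ₀ = γ` (r14 g13), `γ₁ = aL^{−2} + a`, `c₀ = c₁ + c₁′`, `δ₀ =
min{δ₁, δ₁′}` (r14 g14's printed-shape constants), `e₁ = √min{E₀, E₀′, E₀″}`. [cite: Balaban1982Higgs1, Prop. 2.3 (2.33)–(2.38) pp.611–612, Prop. 2.1 (2.23) p.610] -/
theorem prop23Intended_regNestFam23 (d L : ℕ) (hL1 : 1 < L) (N : ℕ) {a msq : ℝ} (ha : 0 < a) (hmsq : 0 < msq) {c : ℝ}
    (hc : 0 ≤ c) : B1.Prop23Intended (regNestFam23 d L N a msq c) := by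
  obtain ⟨E₁, hE₁, γ, hγ, H1⟩ := ineq233_lower_printed_region d L hL1 ha hmsq c N
  obtain ⟨E₂, c₂, δ₂, hE₂, hc₂, hδ₂, H2⟩ := prop23_regular_region d L hL1 ha hmsq hc N
  obtain ⟨E₃, c₃, δ₃, hE₃, hc₃, hδ₃, H3⟩ := prop23_238_regular_region d L hL1 ha hmsq hc N
  have hLr : (1 : ℝ) < (L : ℝ) := by exact_mod_cast hL1
  obtain ⟨E, hE⟩ : ∃ E : ℝ, E = min E₁ (min E₂ E₃) := ⟨_, rfl⟩
  have hEpos : 0 < E := by rw [hE]; exact lt_min hE₁ (lt_min hE₂ hE₃)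
  refine ⟨min δ₂ δ₃, c₂ + c₃, γ, a * ((L : ℝ) ^ 2)⁻¹ + a, Real.sqrt E, lt_min hδ₂ hδ₃, by linarith, hγ, by positivity,
    Real.sqrt_pos.mpr hEpos, ?_⟩
  intro i hreg hbig hepos hele
  obtain ⟨P, hPd, hPL, C, K, hK, R, R₀, j, hjK, hs, hsubΛ, Λ, hΛ, A, δA⟩ := i
  dsimp only [regNestFam23] at hreg hbig hepos hele ⊢
  obtain ⟨hδA, hreg₀, hu⟩ := hreg
  obtain ⟨hU, hU₀⟩ := hbig
  -- the three coupling thresholds from `|e| ≤ √E`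
  have he2 : C.e ^ 2 ≤ E := by
    have h := pow_le_pow_left₀ (abs_nonneg _) hele 2
    rw [sq_abs, Real.sq_sqrt hEpos.le] at h
    exact h
  have heE₁ : C.e ^ 2 ≤ E₁ := he2.trans (by rw [hE]; exact min_le_left _ _)
  have heE₂ : C.e ^ 2 ≤ E₂ := he2.trans (by rw [hE]; exact (min_le_right _ _).trans (min_le_left _ _))
  have heE₃ : C.e ^ 2 ≤ E₃ := he2.trans (by rw [hE]; exact (min_le_right _ _).trans (min_le_right _ _))
  -- regularity on `Ω ⊆ Ω₀`
  have hsubΩ : pieceF R j ⊆ pieceF R₀ j := by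
    intro x hx
    rw [mem_pieceF_iff] at hx ⊢
    exact hsubΛ hx
  have hreg' : ∀ z ∈ pieceF R j, ∀ μ' ν : Fin P.d, |A ⟨z.shift ν, μ'⟩ - A ⟨z, μ'⟩| ≤ δA :=
    fun z hz => hreg₀ z (hsubΩ hz)
  have hlowψ := H1 C heE₁ P hPd hPL R hK j hjK (fun μ => two_le_sitesPerDir _ μ) hs hU A hδA hreg' hu
  subst hPd hPL
  have hm : 0 < P.mesh (j.val + 1) := P.mesh_pos _
  have hc₂₃ : 0 ≤ c₂ + c₃ := by linarith
  refine ⟨?_, ?_, ?_, ?_⟩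
  · -- (2.33): lower half (r14 g13) and upper half (r14 g6)
    intro f hf
    constructor
    · have h := hlowψ (fun y : LSite R j => f y.val)
      rwa [extL_restrict_eq R j hf] at h
    · exact siteInner_precOpA_succ_le_uniform C (pieceF R j) A hmsq ha hLr hjK f
  · -- (2.34)
    intro p q
    have h := (H2 C heE₂ P rfl rfl R hK j hjK hs hU A hδA hreg' hu hΛ p.2 q.2).1
    have ht : 0 ≤ (HiggsLattice.Site.tdist p.1.1 q.1.1 : ℝ) := Nat.cast_nonneg _
    have hmul := mul_le_mul_of_nonneg_left h (sq_nonneg (P.mesh (j.val + 1))⁻¹)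
    rw [mul_assoc (P.mesh (j.val + 1) ^ 2), inv_sq_mul_sq_mul hm] at hmul
    exact hmul.trans (weight_mono (by linarith) hc₂₃ (min_le_left _ _) ht)
  · -- (2.36)
    intro p q
    have h := (H2 C heE₂ P rfl rfl R hK j hjK hs hU A hδA hreg' hu hΛ p.2 q.2).2
    have ht : 0 ≤ (HiggsLattice.Site.tdist p.1.1 q.1.1 : ℝ) + distC Λ p.1.1 + distC Λ q.1.1 :=
      add_nonneg (add_nonneg (Nat.cast_nonneg _) (distC_nonneg _ _)) (distC_nonneg _ _)
    have hmul := mul_le_mul_of_nonneg_left h (sq_nonneg (P.mesh (j.val + 1))⁻¹)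
    rw [mul_assoc (P.mesh (j.val + 1) ^ 2), inv_sq_mul_sq_mul hm] at hmul
    exact hmul.trans (weight_mono (by linarith) hc₂₃ (min_le_left _ _) ht)
  · -- (2.38)
    intro p q
    have h := H3 C heE₃ P rfl rfl R R₀ hK j hjK hs hU hU₀ hsubΛ A hδA hreg₀ hu hΛ p.2 q.2
    have ht : 0 ≤ (HiggsLattice.Site.tdist p.1.1 q.1.1 : ℝ) + distC (R.block j) p.1.1 + distC (R.block j) q.1.1 :=
      add_nonneg (add_nonneg (Nat.cast_nonneg _) (distC_nonneg _ _)) (distC_nonneg _ _)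
    have hmul := mul_le_mul_of_nonneg_left h (sq_nonneg (P.mesh (j.val + 1))⁻¹)
    rw [mul_assoc (P.mesh (j.val + 1) ^ 2), inv_sq_mul_sq_mul hm] at hmul
    exact hmul.trans (weight_mono (by linarith) hc₂₃ (min_le_right _ _) ht)

/-- Hence B4's «Proposition 2.3 of [1]» p. 574 in b04's typing holds on the family (pv07's kernel-checked comparison
`B1.prop23Intended_iff_prop23Printed`). [cite: Balaban1983RegularityDecay, Prop. 2.3 of [1] (1.15)–(1.20) p.574] -/
theorem prop23Printed_regNestFam23 (d L : ℕ) (hL1 : 1 < L) (N : ℕ) {a msq : ℝ} (ha : 0 < a) (hmsq : 0 < msq) {c : ℝ}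
    (hc : 0 ≤ c) : B4.Prop23Printed (regNestFam23 d L N a msq c) :=
  (B1.prop23Intended_iff_prop23Printed _).mp (prop23Intended_regNestFam23 d L hL1 N ha hmsq hc)

/-- **The family is non-vacuous at every threshold**: for every `e₁ > 0` there is a member with `regular`, `bigBlocks` and `0 < e ≤ e₁` (the
torus with `ε = 1/L`, `K = 2`, `M = L′ = 1`; charge `(e₁, q = 0)`; the one-level towers `Λ_1 = Λ⁰_1 = T^{(1)}`, `Λ = T^{(1)}`; `A = 0`, `δ_A = 0`;
needs `d ≥ 1`, `L ≥ 1`, `c ≥ 0`). [cite: Balaban1982Higgs1, (1.2) p.604, (2.23) p.610] -/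
theorem regNestFam23_nonvacuous {d L : ℕ} (hd : 1 ≤ d) (hL : 1 ≤ L) (N : ℕ) (a msq : ℝ) {c : ℝ} (hc : 0 ≤ c) {e₁ : ℝ}
    (he₁ : 0 < e₁) :
    ∃ i : RegNestIdx d L N,
      (regNestFam23 d L N a msq c i).regular ∧ (regNestFam23 d L N a msq c i).bigBlocks ∧
      0 < (regNestFam23 d L N a msq c i).e ∧ (regNestFam23 d L N a msq c i).e ≤ e₁ := by
  have hL0 : 0 < L := by omega
  have hLr : (0 : ℝ) < (L : ℝ) := by exact_mod_cast hL0
  set P : HiggsLattice.Params := ⟨d, 1 / L, 2, L, 1, fun _ => 1, hd, by positivity, hL0, one_pos, fun _ => one_pos⟩ with hP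
  have hmesh : P.mesh 1 ≤ 1 := by
    show (L : ℝ) ^ 1 * (1 / L) ≤ 1
    rw [pow_one, mul_one_div_cancel hLr.ne']
  set C : ChargeData N := ⟨e₁, 0, by rw [neg_zero]; exact star_zero (EuclideanSpace ℝ (Fin N) →L[ℝ] EuclideanSpace ℝ (Fin N)),
    by rw [norm_zero]; exact zero_le_one⟩ with hC
  set R : Regions P 2 := ⟨∅, fun _ => Finset.univ⟩ with hR
  refine ⟨⟨P, rfl, rfl, C, 2, le_rfl, R, R, ⟨0, by omega⟩, by show 0 + 1 < 2; omega, hmesh, le_rfl, Finset.univ,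
    Finset.subset_univ _, 0, 0⟩, ?_, ?_, ?_, ?_⟩
  · dsimp only [regNestFam23]
    refine ⟨le_rfl, fun z _ μ' ν => ?_, ?_⟩
    · rw [Pi.zero_apply, Pi.zero_apply, sub_self, abs_zero]
    · rw [mul_zero]
      exact mul_nonneg hc (abs_nonneg _)
  · dsimp only [regNestFam23]
    exact ⟨fun y y' _ => by simp [hR], fun y y' _ => by simp [hR]⟩
  · show 0 < |e₁|
    rw [abs_of_pos he₁]; exact he₁
  · show |e₁| ≤ e₁
    rw [abs_of_pos he₁]

end Literature.MathematicalPhysics.QuantumFieldTheory.Balaban1983to89.B1Prop23RegularRegionFam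

end
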